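import Summits.CriticalPhenomena.SAWScalingLimit.Theorems.SAWLeftRightFKGFKGToTraversalBoundKilledWalkCollarBound
import Literature.Probability.LatticeModels.KemppainenSmirnovDeadEndBound
import HarnessLib

/-!
# Stub `stub_killedWalkCollarBound` (line `excursion-domination`, crux `FKGToTraversalBound`,
stmt-CriticalPhenomena-1878) under the named fact `KemppainenSmirnov2017_rwDeadEndBound`

The registered signature of `stub_killedWalkCollarBound`, verbatim, from the named literature fact
`Literature.Probability.LatticeModels.KemppainenSmirnov2017_rwDeadEndBound` (Kemppainen–Smirnov 2017,
random-walk form of Condition G2, site form on hole-free subsets of `ℤ²`; statement only, tracked debt):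
`stub_killedWalkCollarBound_of_deadEndBound` of `…KilledWalkCollarBound.lean` (which proves the signature
under that statement spelled out, using the tree's weak Beurling estimate for the diagonal case and the
unforced-passage topology of `…KilledWalkCollarPassage.lean`) applied to the named fact. This is the
form the line's skeleton wires: `stub_killedWalkCollarBound := stub_killedWalkCollarBound_of_KS ‹_›`.
[folklore]
-/

noncomputable section

open SimpleGraph
open Literature.Probability.LatticeModels

namespace Summit.CriticalPhenomena.SAWScalingLimit.Theorems.FKGToTraversalBound.ExcursionDomination.KilledWalkCollar

/-- **Worker sub-goal `stub_killedWalkCollarBound_of_KS`** (registered): the registered signature of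
`stub_killedWalkCollarBound` under the named fact `KemppainenSmirnov2017_rwDeadEndBound`
(`stub_killedWalkCollarBound_of_deadEndBound` applied to it). [folklore] -/
theorem stub_killedWalkCollarBound_of_KS : KemppainenSmirnov2017_rwDeadEndBound →
    ∃ (M η : ℝ), 1 < M ∧ 0 < η ∧ ∀ (δ : ℝ) (Λ : Finset (Site 2)) (a b : Site 2), 0 < δ →
      HoleFree (↑Λ : Set (Site 2)) →
      ∀ (z₀ : ℂ) (r R : ℝ) (H : Finset (Site 2)), δ ≤ r → M * r ≤ R →
        (∃ V : Finset (Site 2), V ⊆ Λ ∧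
          (∀ x ∈ V, r ≤ dist (meshPoint δ x) z₀ ∧ dist (meshPoint δ x) z₀ ≤ R) ∧
          (∃ p : (zdGraph 2).Walk a b, ∀ x ∈ p.support, x ∈ Λ ∧ x ∉ V) ∧
          (∀ y, (∃ p : (zdGraph 2).Walk a y, ∀ x ∈ p.support, x ∈ Λ ∧ x ∉ V) → y ∉ H) ∧
          (∀ x ∈ V, x ∉ H) ∧
          (∃ p : Site 2, p ∉ Λ ∧ dist (meshPoint δ p) z₀ ≤ r + δ) ∧
          ((∀ x ∈ V, ∀ y ∈ Λ, y ∉ V → (zdGraph 2).Adj x y →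
              ((∃ p : (zdGraph 2).Walk a y, ∀ x ∈ p.support, x ∈ Λ ∧ x ∉ V) →
                dist (meshPoint δ y) z₀ < r) ∧
              ((∃ h ∈ H, (∃ p : (zdGraph 2).Walk y h, ∀ x ∈ p.support, x ∈ Λ ∧ x ∉ V)) →
                R < dist (meshPoint δ y) z₀)) ∨
           (∀ x ∈ V, ∀ y ∈ Λ, y ∉ V → (zdGraph 2).Adj x y →
              ((∃ p : (zdGraph 2).Walk a y, ∀ x ∈ p.support, x ∈ Λ ∧ x ∉ V) →
                R < dist (meshPoint δ y) z₀) ∧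
              ((∃ h ∈ H, (∃ p : (zdGraph 2).Walk y h, ∀ x ∈ p.support, x ∈ Λ ∧ x ∉ V)) →
                dist (meshPoint δ y) z₀ < r)))) →
        η * dirichletGreen Λ a b ≤ dirichletGreen (Λ \ H) a b :=
  fun hKS => stub_killedWalkCollarBound_of_deadEndBound hKS

end Summit.CriticalPhenomena.SAWScalingLimit.Theorems.FKGToTraversalBound.ExcursionDomination.KilledWalkCollar
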